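import Summits.PneNP.PneNP.Theses.SymmetryBudget
import Summits.PneNP.PneNP.Theorems.SymmetryBudgetRigidBenchmarkCalibration
import Literature.Combinatorics.SimpleGraph.PendantPathRigidificationColour
import Literature.Computability.Complexity.CircuitComposition
import Literature.Computability.Complexity.CircuitClassesProofs
import Literature.Computability.Complexity.CircuitLowerBounds

/-!
# Calibration of `SymmetryBudget.RigidBenchmark` (item stmt-PneNP-2149), IV:
# the plain circuit lower bound for 3-colourability IMPLIES the benchmark

The converse of `SymmetryBudgetRigidBenchmarkPlainLowerBound.lean`:

  `threeColHardIO_imp_rigidBenchmark :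
     (∀ q, ∃ᶠ n, ¬ ∃ D over tcBasis, |D| ≤ q n ∧ D computes x ↦ [Gr x is 3-colourable])
       → RigidBenchmark`,

by PENDANT-PATH RIGIDIFICATION (`Literature/Combinatorics/SimpleGraph/PendantPathRigidification*.lean`):
every `n`-vertex graph `Gr x` is turned into the CR-discrete graph `Gr (rigidMatrix x)` on
`rigidSize n ≤ n + n·((n+3)n+1)²` vertices, 3-colourable iff `Gr x` is, whose adjacency matrix
consists of entries of `x` and constants; so a circuit (symmetric or not) that is correct on the
CR-discrete inputs of size `rigidSize n` yields, after hard-wiring the gadget (one constant gate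
per entry at worst), a circuit correct on ALL inputs of size `n`. Together with the forward
direction (`rigidBenchmark_imp_threeColHardIO`, `SymmetryBudgetRigidBenchmarkPlainLowerBound.lean`)
this gives `RigidBenchmark ↔ ThreeColHardIO` (the corollary `rigidBenchmark_iff_threeColHardIO` is
appended to this file once the forward direction has landed) — the route's rigid-instance
benchmark IS the plain (non-symmetric, non-uniform) circuit lower bound for 3-colourability in the
matrix convention, no more and no less; full symmetry and the promise to
colour-refinement-discrete inputs change nothing.
-/

-- `Summit.PneNP.PneNP.…` duplicates `PneNP` BY DESIGN (single-problem summit, D-0017); the Summits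
-- library sets this option globally (lakefile), repeated here so a standalone `lean check` is warning-free.
set_option linter.dupNamespace false

namespace Summit.PneNP.PneNP.Theorems

open Literature.Computability.Complexity Literature.Combinatorics.SimpleGraph Filter Polynomial
open Summit.PneNP.PneNP.Theses.SymmetryBudget (RigidBenchmark)
open scoped Classical

/-- **The gadget matrix costs at most one gate per entry**: `x ↦ rigidMatrix x` is computed by a
`tcBasis`-program with at most `|Fin M × Fin M|` gates (projections are free, constants are
`∧₀` / `∨₀`). -/
theorem cktSize_rigidMatrix (n : ℕ) :
    CktSize tcBasis (fun (x : Fin n × Fin n → Bool) (q : Fin (rigidSize n) × Fin (rigidSize n)) =>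
      rigidMatrix x q) (Fintype.card (Fin (rigidSize n) × Fin (rigidSize n)) * 1) := by
  refine CktSize.pi_const fun q => ?_
  by_cases h : ∃ i i', (rigidEquiv n).symm q.1 = Sum.inl i ∧ (rigidEquiv n).symm q.2 = Sum.inl i'
  · obtain ⟨i, i', hi, hi'⟩ := h
    refine ((CktSize.proj tcBasis fun _ : Unit => (i, i')).of_le (Nat.zero_le 1)).congr fun x _ => ?_
    show x (i, i') = rigidEntry x ((rigidEquiv n).symm q.1) ((rigidEquiv n).symm q.2)
    rw [hi, hi']
    rfl
  · have hconst : ∀ x : Fin n × Fin n → Bool,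
        rigidMatrix x q = rigidEntry (fun _ => false) ((rigidEquiv n).symm q.1) ((rigidEquiv n).symm q.2) :=
      fun x => rigidEntry_eq_of_not x _ _ _ h
    cases hb : rigidEntry (fun _ : Fin n × Fin n => false) ((rigidEquiv n).symm q.1) ((rigidEquiv n).symm q.2)
    · refine (CktSize.gate (B := tcBasis) (ι := Fin n × Fin n) (GateFn.or 0)
        (acBasis_subset_tcBasis (Or.inr (Set.mem_iUnion.2 ⟨0, Or.inr rfl⟩))) Fin.elim0).congr fun x _ => ?_
      rw [hconst x, hb]
      simp [GateFn.or]
    · refine (CktSize.gate (B := tcBasis) (ι := Fin n × Fin n) (GateFn.and 0)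
        (acBasis_subset_tcBasis (Or.inr (Set.mem_iUnion.2 ⟨0, Or.inl rfl⟩))) Fin.elim0).congr fun x _ => ?_
      rw [hconst x, hb]
      simp [GateFn.and]

/-- **Hard-wiring the gadget.** A `tcBasis`-circuit `C` on `rigidSize n × rigidSize n` matrices that
agrees with 3-colourability on the CR-discrete inputs yields a `tcBasis`-circuit on `n × n`
matrices, with at most `rigidSize n ² + |C|` gates, computing 3-colourability of `Gr x` for ALL
`x`. -/
theorem exists_general_of_discrete {n : ℕ} (C : Circuit (Fin (rigidSize n) × Fin (rigidSize n)))
    (hCB : C.IsOver tcBasis)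
    (hC : ∀ y : Fin (rigidSize n) × Fin (rigidSize n) → Bool, IsCRDiscrete (GrM y) →
      C.eval y = decide ((GrM y).Colorable 3)) :
    ∃ D : Circuit (Fin n × Fin n), D.IsOver tcBasis ∧
      D.size ≤ rigidSize n * rigidSize n + C.size ∧
      D.Computes (fun x => decide ((GrM x).Colorable 3)) := by
  have hP := (cktSize_rigidMatrix n).comp (C.cktSize_eval hCB)
  obtain ⟨D, hDB, hDs, hDe⟩ := hP.toCircuit
  refine ⟨D, hDB, ?_, fun x => ?_⟩
  · simpa using hDs
  · rw [hDe x]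
    show C.eval (rigidMatrix x) = _
    rw [hC _ (isCRDiscrete_grM_rigidMatrix x), grM_rigidMatrix_colorable_iff]

/-- A polynomial bound for `rigidSize`. -/
theorem rigidSize_le_eval (n : ℕ) :
    rigidSize n ≤ (X + X * ((X + 3) * X + 1) ^ 2 : Polynomial ℕ).eval n := by
  have h := rigidSize_le n
  have heval : (X + X * ((X + 3) * X + 1) ^ 2 : Polynomial ℕ).eval n = n + n * (hairBound n * hairBound n) := by
    simp [hairBound, pow_two]
  rw [heval]
  exact h

/-- **The plain circuit lower bound for 3-colourability implies `RigidBenchmark`.** If for every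
polynomial `q`, frequently in `n`, no `tcBasis`-circuit of size `≤ q n` computes 3-colourability
of `Gr x` for all `n × n` matrices `x`, then for every polynomial `p`, frequently in `m`, no FULLY
SYMMETRIC `tcBasis`-circuit of size `≤ p m` agrees with 3-colourability on the CR-discrete
`m × m` inputs (indeed no circuit at all does). -/
theorem threeColHardIO_imp_rigidBenchmark
    (h : ∀ q : Polynomial ℕ, ∃ᶠ n in atTop, ¬ ∃ D : Circuit (Fin n × Fin n), D.IsOver tcBasis ∧
      D.size ≤ q.eval n ∧ ∀ x : Fin n × Fin n → Bool,
        D.eval x = decide ((SimpleGraph.fromRel fun u v => x (u, v) = true :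
          SimpleGraph (Fin n)).Colorable 3)) :
    RigidBenchmark := by
  rw [rigidBenchmark_iff]
  intro p
  by_contra hcon
  rw [Filter.not_frequently] at hcon
  simp only [not_not] at hcon
  obtain ⟨M₀, hM₀⟩ := Filter.eventually_atTop.1 hcon
  set S : Polynomial ℕ := X + X * ((X + 3) * X + 1) ^ 2 with hS
  have hev : ∀ᶠ n in atTop, ∃ D : Circuit (Fin n × Fin n), D.IsOver tcBasis ∧
      D.size ≤ (S * S + p.comp S).eval n ∧ ∀ x : Fin n × Fin n → Bool,
        D.eval x = decide ((SimpleGraph.fromRel fun u v => x (u, v) = true :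
          SimpleGraph (Fin n)).Colorable 3) := by
    refine Filter.eventually_atTop.2 ⟨M₀, fun n hn => ?_⟩
    obtain ⟨C, hCB, hCs, -, hC⟩ := hM₀ (rigidSize n) (hn.trans (le_rigidSize n))
    obtain ⟨D, hDB, hDs, hDc⟩ := exists_general_of_discrete C hCB hC
    refine ⟨D, hDB, ?_, hDc⟩
    have hR := rigidSize_le_eval n
    rw [← hS] at hR
    have h1 : rigidSize n * rigidSize n ≤ S.eval n * S.eval n := Nat.mul_le_mul hR hR
    have h2 : p.eval (rigidSize n) ≤ p.eval (S.eval n) := natPoly_eval_mono p hR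
    rw [eval_add, eval_mul, eval_comp]
    omega
  obtain ⟨n, hno, hyes⟩ := ((h (S * S + p.comp S)).and_eventually hev).exists
  exact hno hyes

end Summit.PneNP.PneNP.Theorems
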